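import Mathlib
import Summits.ResolutionOfSingularities.ResolutionOfSingularities.Theses.HomologicalConductor
import Summits.ResolutionOfSingularities.ResolutionOfSingularities.Theorems.HomologicalConductorPersistenceTwoStepTransfer
import Summits.ResolutionOfSingularities.ResolutionOfSingularities.Theorems.HomologicalConductorPersistenceTwoStepTransferExponentTwo
import HarnessLib

/-!
# Crux `Persistence` (stmt-ResolutionOfSingularities-16484) — persistence read LEVEL BY LEVEL

[OURS · L1 w44b · idea-1 card A4 / memo N10; AI-written and AI-reviewed only (weaker than expert review);
NOT a statement of the manuscript under study, and no statement of that manuscript is used here.]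

Route `ResolutionOfSingularities/HomologicalConductor`, crux
`Summit.ResolutionOfSingularities.ResolutionOfSingularities.Theses.HomologicalConductor.Persistence`
("along the canonical tower `T_m`, `ca(T_m) ⊆ ca(T_(m+1))`", `ca = ⋃ₙ caⁿ`, `caⁿ = ann Ext^{≥ n}(f.g., f.g.)`).

This module only FIXES VOCABULARY used by the w44b crux chain (CHAIN v5 / CRUX-PLAN-v5 §5, ASSIGN v0.9 row idea-1)
and records the one formal implication between the levelled statements and the crux:

* `LevelPersistence n` — the crux with its conclusion levelled: `caⁿ(T_m) ⊆ caⁿ(T_(m+1))` for every `m`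
  (the tower — `loc`, `chart`, `nrm`, `tower` — is VERBATIM the crux's; the chart is still cut out by the full `ca`);
* `LevelFourPersistenceFails := ¬ LevelPersistence 4` — the negative bench candidate N10/N11 of the chain
  (exact graded linear algebra over `GF(p)`, `p ∈ {2,3,7,10007,32003}`, on the stub-2 tower `A = k[x,t,z,u]/(xt - z³)`,
  `O` monomial `(4,3,1)`: `x = a³ ∈ ca⁴(T₀)` but `a³ • Ext⁴_{T₁}(M, Ω⁴M) ≠ 0` for `M = T₁/(a²b - u², ab², b³, a³u)`,
  `T₁ = (k[a³,a²b,ab²,b³][u])_Q`; NUMERICAL EVIDENCE ONLY — nothing about it is proved here, the `def` merely names it);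
* `persistence_of_forall_levelPersistence : (∀ n, LevelPersistence n) → Persistence` (trivial: `ca = ⋃ₙ caⁿ`).

The converse direction is where the content of the chain lives: by N10/N11 the level CANNOT be taken uniform along the
tower, and the algebraic engine for the level shift is the two-step transfer of
`Theorems/HomologicalConductorPersistenceTwoStepTransfer.lean` (`exists_comp_eq_smul_id_of_twoStep`,
`smul_ext_eq_zero_of_twoStep`: level ONE under the secondary-obstruction hypothesis `hext`) and of
`Theorems/HomologicalConductorPersistenceTwoStepTransferExponentTwo.lean` (`mul_smul_ext_eq_zero_of_twoStep_of_two_le`,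
`mul_mem_cohomologyAnnihilatorOfDegree_two_of_forall_twoStep`: exponent TWO, level `≥ 2`, no obstruction hypothesis) —
imported here BY NAME, not restated.
-/

set_option linter.dupNamespace false

namespace Summit.ResolutionOfSingularities.ResolutionOfSingularities.Theorems.HomologicalConductor.PersistenceLevel

/-- [OURS · L1 w44b · idea-1 A4/N10] PERSISTENCE AT A FIXED Ext-LEVEL `n`: along the crux's canonical tower
`T_m → T_(m+1) = loc (nrm (chart T_m))` (binders and `let`s verbatim those of
`Theses.HomologicalConductor.Persistence`; the chart is cut out by the full `ca`), the level-`n` annihilator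
`caⁿ(B) = {x ∈ B | x • Ext^i_B(M, N) = 0 for all i ≥ n and all finite M, N}` only grows:
`caⁿ(T_m) ⊆ caⁿ(T_(m+1))` for every `m`.  NOT a statement of the manuscript. -/
def LevelPersistence (n : ℕ) : Prop :=
  ∀ p : ℕ, p.Prime → ∀ (k K : Type) [Field k] [CharP k p] [Field K] [Algebra k K] (O : ValuationSubring K) (A : Subalgebra k K), (∀ c : k, algebraMap k K c ∈ O) → A.FG → IsFractionRing ↥A K → A.toSubring ≤ O.toSubring → let caAt : ℕ → Subalgebra k K → Set K := fun n A => {x : K | ∃ hx : x ∈ A, ∀ i : ℕ, n ≤ i → ∀ (M N : ModuleCat.{0} ↥A), Module.Finite ↥A M → Module.Finite ↥A N → ∀ e : CategoryTheory.Abelian.Ext.{0} M N i, (⟨x, hx⟩ : ↥A) • e = 0}; let ca : Subalgebra k K → Set K := fun A => {x : K | ∃ hx : x ∈ A, ∃ n : ℕ, ∀ i : ℕ, n ≤ i → ∀ (M N : ModuleCat.{0} ↥A), Module.Finite ↥A M → Module.Finite ↥A N → ∀ e : CategoryTheory.Abelian.Ext.{0} M N i, (⟨x, hx⟩ : ↥A)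 • e = 0}; let loc : Subalgebra k K → Subalgebra k K := fun A => Algebra.adjoin k {y : K | ∃ a ∈ A, ∃ s ∈ A, s⁻¹ ∈ O ∧ y = a * s⁻¹}; let chart : Subalgebra k K → Subalgebra k K := fun A => Algebra.adjoin k ((A : Set K) ∪ {y : K | ∃ c ∈ ca A, ∃ x ∈ ca A, x ≠ 0 ∧ (∀ c' ∈ ca A, c' * x⁻¹ ∈ O) ∧ y = c * x⁻¹}); let nrm : Subalgebra k K → Subalgebra k K := fun B => Algebra.adjoin k {y : K | IsIntegral ↥B y}; let tower : Subalgebra k K → ℕ → Subalgebra k K := fun A m => @Nat.rec (fun _ => Subalgebra k K) (loc A) (fun _ B => loc (nrm (chart B))) m; ∀ m : ℕ, caAt n (tower A m) ⊆ caAt n (tower A (m + 1))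

/-- [OURS · L1 w44b · idea-1 N10/N11; tri-2: definition only] the negative bench candidate "level-`4` persistence
fails" (`4 = dim T₀ + 1` on the stub-2 threefold tower; evidence = exact graded stable-annihilator computations over
five primes, see the module docstring — NOT proved here, and NOT a statement of the manuscript). -/
def LevelFourPersistenceFails : Prop := ¬ LevelPersistence 4

/-- `ca = ⋃ₙ caⁿ`: persistence at every fixed level implies the crux `Persistence` (the converse is the open content). -/
theorem persistence_of_forall_levelPersistence (h : ∀ n, LevelPersistence n) :
    Summit.ResolutionOfSingularities.ResolutionOfSingularities.Theses.HomologicalConductor.Persistence := by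
  intro p hp k K _ _ _ _ O A hk hA hfr hAO ca loc chart nrm tower m x hx
  obtain ⟨hxA, n, hn⟩ := hx
  have hstep := h n p hp k K O A hk hA hfr hAO m
  obtain ⟨hx', h'⟩ := hstep ⟨hxA, hn⟩
  exact ⟨hx', n, h'⟩

end Summit.ResolutionOfSingularities.ResolutionOfSingularities.Theorems.HomologicalConductor.PersistenceLevel
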